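import Summits.BirchSwinnertonDyer.BirchSwinnertonDyer.Theorems.RamifiedSevenEllipticUnitsKummerFamiliesSelmer
import Literature.NumberTheory.EllipticCurves.PeriodIndexCorestrictionLocal
import HarnessLib

set_option linter.dupNamespace false
set_option autoImplicit false

/-!
# Route `RamifiedSevenEllipticUnits` (rung K7r), value crux (19705 → its D117 successor), line
# `rubin-formula-zp`, stub S_sat — the LOCAL SATURATION lemma: the compact Selmer group `S_p(E/K)` is
# saturated in the relaxed one `S_{p,rel}(E/K)` (`S_rel/S_f` is torsion-free) (PROVED; `--supports 19705`)

Cell `bsd-cm`, seat `bsd-cm-k7r-c2` g4 (CLAIM on STATUS 19:58Z; planner D117 (3): S_sat = «relaxed ≤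
torsion ⊔ Mordell–Weil Kummer span at the bottom» splits into a rank count and two SATURATION facts; this
file is the local one, needed by BOTH the GZK and the GZK-free variant of S_sat). HONEST FRAMING: carrier
lemmas only; nothing about any curve's arithmetic is asserted; BSD is not proved; no named fact is
minted; every theorem is `sorry`-free.

## The statement and the argument (Tate-module torsion-freeness, in the tree's finite-level currency)

For a `p`-compatible family `x = (x_k)_k ∈ ∏_k H¹(H, E[p^k])` and a local restriction
`loc : H¹(H, E[p^k]) → H¹(H_E, E(K̄_E))` at the place singled out by an embedding `ι`, put
`y_k := loc(x_k)`. Then (T1) `y_k = p · y_{k+1}` — `loc` factors through the torsion-coefficient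
restriction (`localResTorsionOverOfEmb_eq_comp`), which commutes with `p_*`
(`localTorsionResOfEmb_reduceTorsionH1`), and the coefficient map `E[p^{k+1}] →(p·) E[p^k] ⊆ E` is `p`
times `E[p^{k+1}] ⊆ E` (`torsionToPointsH1_reduceTorsionH1`); (T2) `p^k · y_k = 0` (`y_k` is the image of
a class with `p^k`-torsion coefficients); hence (T3) if `N · y_k = 0` for all `k` and some `N ≠ 0`, then
`y_k = 0` for all `k` (write `|N| = p^e u`, `p ∤ u`: `u · y_k = |N| · y_{k+e} = 0` and `p^k · y_k = 0`,
Bézout) — `(y_k)_k` is an element of the Tate module `T_p H¹(H_E, E(K̄_E))`, which is torsion-free.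
Consequently (T4) a compatible family some non-zero multiple of which is Kummer at `ι` is itself Kummer
at `ι` (any field, any `H`), and (T5) at the bottom layer of a `ℤ_p`-tower over a number field:
**`x ∈ S_{p,rel}(E/K)`, `N ≠ 0`, `N · x ∈ S_p(E/K)` ⟹ `x ∈ S_p(E/K)`** (`mem_compactSelmerOver_of_zsmul_mem`),
so **`[S_{p,rel} : S_p] < ∞ ⟹ S_{p,rel} = S_p`** (`relaxedCompactSelmerOver_eq_of_relIndex_ne_zero`).
Reading: `S_{p,rel}(E/K)/S_p(E/K) ↪ H¹(K_𝔭, T)/H¹_f(K_𝔭, T) ↪ T_p H¹(K_𝔭, E)` is torsion-free (Bloch–Kato: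
`H¹_f` is saturated; [BKNO] §3.1.2), so «relaxed = compact at the bottom» reduces to the RANK statement
`rk S_{p,rel} = rk S_p` (global duality; or `hc ∧ hm ∧` Mattuck `∧ rk End_K ≤ 2`, k8i-c2 g7 §4 /
k7r-c4 g5's ALTERNATIVE S_sat) — the remaining content of S_sat on this side.

References: S. Bloch, K. Kato (1990) §3 (`H¹_f`, Ex. 3.11) [BlochKato1990]; J. Tate, *Relations between
K₂ and Galois cohomology*, Invent. Math. 36 (1976) §2 (`H¹(K, T) = lim H¹(K, E[p^k])`; Tate modules are
torsion-free) [Tate1976K2]; B. Perrin-Riou, Bull. SMF 115 (1987) §0 [PerrinRiou1987BSMF]; [BKNO]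
arXiv:2608.06879v1 §3.1.2 [BurungaleKobayashiNakamuraOta2026]; J.-P. Serre, *Local Fields* VII.§5 Prop. 3
[SerreLocalFields1979].
-/

noncomputable section

open scoped Classical

open WeierstrassCurve NumberField IsDedekindDomain Field
  Literature.NumberTheory.EllipticCurves
  Literature.NumberTheory.GaloisRepresentations
  Literature.NumberTheory.EllipticCurves.BurungaleKobayashiNakamuraOta2026

universe u

namespace Summit.BirchSwinnertonDyer.BirchSwinnertonDyer.Theorems.RamifiedSevenEllipticUnits

namespace RelaxedSelmerSaturation

/-! ## T3. The abstract Tate-module lemma -/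

section Tate

variable {A : Type*} [AddCommGroup A]

/-- Iterating the transition: `y_k = p^j · y_{k+j}`. [cite: Tate1976K2, §2 (Tate modules; shape only)] -/
theorem eq_pow_nsmul_of_step (p : ℕ) (y : ℕ → A) (hstep : ∀ k, y k = p • y (k + 1)) (k j : ℕ) :
    y k = (p ^ j) • y (k + j) := by
  induction j with
  | zero => simp
  | succ j ih => rw [ih, hstep (k + j), smul_smul, ← pow_succ, Nat.add_assoc]

/-- **A `p`-divisible tower of `p^k`-torsion elements killed by a non-zero integer is zero**
(`(y_k)_k` with `y_k = p · y_{k+1}`, `p^k · y_k = 0`, `N · y_k = 0`, `N ≠ 0` ⟹ `y_k = 0`): write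
`|N| = p^e u` with `p ∤ u`; then `u · y_k = |N| · y_{k+e} = 0` and `p^k · y_k = 0`, and `gcd(u, p^k) = 1`.
The torsion-freeness of a Tate module. [cite: Tate1976K2, §2 (Tate modules are torsion-free; shape only)] -/
theorem eq_zero_of_tower {p : ℕ} (hp : p.Prime) (y : ℕ → A) (hstep : ∀ k, y k = p • y (k + 1))
    (htors : ∀ k, (p ^ k) • y k = 0) {N : ℤ} (hN : N ≠ 0) (hkill : ∀ k, N • y k = 0) (k : ℕ) :
    y k = 0 := by
  have hn : N.natAbs ≠ 0 := Int.natAbs_ne_zero.2 hN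
  have hkill' : ∀ k, N.natAbs • y k = 0 := fun k ↦ by
    rw [← natCast_zsmul, ← Int.sign_mul_self_eq_natAbs, mul_zsmul, hkill k, zsmul_zero]
  obtain ⟨e, u, hu, hNeu⟩ := Nat.exists_eq_pow_mul_and_not_dvd hn p hp.ne_one
  have hu0 : u • y k = 0 := by
    have h := hkill' (k + e)
    rw [hNeu, mul_comm, mul_smul, ← eq_pow_nsmul_of_step p y hstep k e] at h
    exact h
  have hcop : Nat.Coprime (p ^ k) u := Nat.Coprime.pow_left k ((Nat.Prime.coprime_iff_not_dvd hp).2 hu)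
  obtain ⟨a, b, hab⟩ := Nat.isCoprime_iff_coprime.2 hcop
  calc y k = (1 : ℤ) • y k := (one_zsmul _).symm
    _ = (a * (p ^ k : ℕ) + b * u) • y k := by rw [hab]
    _ = a • ((p ^ k) • y k) + b • (u • y k) := by
        rw [add_zsmul, mul_zsmul, mul_zsmul, natCast_zsmul, natCast_zsmul]
    _ = 0 := by rw [htors k, hu0, zsmul_zero, zsmul_zero, add_zero]

end Tate

/-! ## T1, T2. The points-coefficient map along the tower: `loc ∘ p_* = p · loc`, `p^k · loc = 0` -/

section Points

variable {K : Type u} [Field K] (W : WeierstrassCurve K)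
variable {E : Type u} [Field E] [Algebra K E]

/-- **`E[p^{k+1}] →(p·) E[p^k] ⊆ E(K̄_E)` is `p` times `E[p^{k+1}] ⊆ E(K̄_E)` on `H¹`**: for the local curve
`W_E` and `H' ≤ Γ_E`, `torsionToPointsH1 (p^k) ∘ reduceTorsionH1 = p · torsionToPointsH1 (p^{k+1})` (on
cocycle representatives both are `σ ↦ p · f(σ)` read in `E(K̄_E)`). Perrin-Riou 1987 §0 (the transition
maps of `S_p(L)` are induced by multiplication by `p`). [cite: PerrinRiou1987BSMF, §0 p. 401] -/
theorem torsionToPointsH1_reduceTorsionH1 (p k : ℕ) (H' : Subgroup (Field.absoluteGaloisGroup E))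
    (c : (W.baseChange E).torsionH1Over ((p : ℤ) ^ (k + 1)) H') :
    W.torsionToPointsH1 ((p : ℤ) ^ k) H' ((W.baseChange E).reduceTorsionH1 p k H' c) =
      p • W.torsionToPointsH1 ((p : ℤ) ^ (k + 1)) H' c := by
  obtain ⟨f, rfl⟩ :=
    oneCocycleClass_surjective (discreteTopRep H' (geomTorsion (W.baseChange E) ((p : ℤ) ^ (k + 1)))) c
  rw [WeierstrassCurve.reduceTorsionH1, WeierstrassCurve.torsionToPointsH1,
    WeierstrassCurve.torsionToPointsH1, ← map_nsmul, ← Nat.cast_smul_eq_nsmul ℤ,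
    ← oneCocycleClass_smul, resH1Hom_oneCocycleClass, resH1Hom_oneCocycleClass,
    resH1Hom_oneCocycleClass]
  congr 1

/-- **`p^k · loc(c) = 0` in `H¹(H_E, E(K̄_E))`** for a class `c` with `E[p^k]`-coefficients (`p^k` kills
`H¹(H_E, E[p^k])`, `KummerFamiliesSelmer.pow_nsmul_torsionH1Over_eq_zero`, p464144).
[cite: SerreGaloisCohomology1997, I.§2.2] -/
theorem pow_nsmul_torsionToPointsH1_eq_zero (p k : ℕ) (H' : Subgroup (Field.absoluteGaloisGroup E))
    (c : (W.baseChange E).torsionH1Over ((p : ℤ) ^ k) H') :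
    (p ^ k) • W.torsionToPointsH1 ((p : ℤ) ^ k) H' c = 0 := by
  rw [← map_nsmul, KummerFamiliesSelmer.pow_nsmul_torsionH1Over_eq_zero, map_zero]

end Points

/-! ## T4. A compatible family with a non-zero multiple Kummer at `ι` is Kummer at `ι` (any field, any `H`) -/

section Saturation

variable {K : Type u} [Field K] (V : WeierstrassCurve K) (p : ℕ) [Fact p.Prime]
  (H : Subgroup (Field.absoluteGaloisGroup K))
  {E : Type u} [Field E] [Algebra K E] (ι : AlgebraicClosure K →ₐ[K] AlgebraicClosure E)

/-- **Local Kummer conditions are saturated among `p`-compatible families**: if `x = (x_k)_k` is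
`p`-compatible and, for some integer `N ≠ 0`, every `N · x_k` dies in `H¹(H_E, E(K̄_E))` under the local
restriction at `ι`, then every `x_k` already dies there. Proof: `y_k := loc(x_k)` satisfies
`y_k = p · y_{k+1}` (T1 + `localResTorsionOverOfEmb_eq_comp` + `localTorsionResOfEmb_reduceTorsionH1`),
`p^k · y_k = 0` (T2) and `N · y_k = 0`; apply `eq_zero_of_tower`. Equivalently: `H¹(L_w, T_pE)/H¹_f` is
torsion-free (Bloch–Kato). [cite: BlochKato1990, §3 Example 3.11 (`H¹_f` = Kummer image; shape only)]
[cite: Tate1976K2, §2 (Tate modules are torsion-free; shape only)] -/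
theorem localResTorsionOverOfEmb_eq_zero_of_zsmul {x : V.torsionH1Pi p H} (hx : x ∈ V.compatiblePi H p)
    {N : ℤ} (hN : N ≠ 0) (h : ∀ k, V.localResTorsionOverOfEmb ((p : ℤ) ^ k) H ι (N • x k) = 0)
    (k : ℕ) : V.localResTorsionOverOfEmb ((p : ℤ) ^ k) H ι (x k) = 0 := by
  rw [mem_compatiblePi_iff] at hx
  refine eq_zero_of_tower (A := discreteH1 (localSubgroupOfEmb H ι) (localPoints V E))
    (Fact.out : p.Prime) (fun j ↦ V.localResTorsionOverOfEmb ((p : ℤ) ^ j) H ι (x j)) ?_ ?_ hN ?_ k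
  · intro j
    show V.localResTorsionOverOfEmb ((p : ℤ) ^ j) H ι (x j) =
      p • V.localResTorsionOverOfEmb ((p : ℤ) ^ (j + 1)) H ι (x (j + 1))
    rw [← hx j, localResTorsionOverOfEmb_eq_comp, localResTorsionOverOfEmb_eq_comp,
      AddMonoidHom.coe_comp, AddMonoidHom.coe_comp, Function.comp_apply, Function.comp_apply,
      localTorsionResOfEmb_reduceTorsionH1, torsionToPointsH1_reduceTorsionH1]
  · intro j
    show (p ^ j) • V.localResTorsionOverOfEmb ((p : ℤ) ^ j) H ι (x j) = 0
    rw [localResTorsionOverOfEmb_eq_comp, AddMonoidHom.coe_comp, Function.comp_apply,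
      pow_nsmul_torsionToPointsH1_eq_zero]
  · intro j
    show N • V.localResTorsionOverOfEmb ((p : ℤ) ^ j) H ι (x j) = 0
    rw [← map_zsmul]
    exact h j

end Saturation

/-! ## T5. Bottom layer over a number field: `S_p(E/K)` is saturated in `S_{p,rel}(E/K)` -/

section Bottom

variable {K : Type u} [Field K] [NumberField K] (V : WeierstrassCurve K) (p : ℕ) [Fact p.Prime]
  (κ : ZpExtension K p)

omit [NumberField K] in
/-- Conjugation by any `σ ∈ Γ_K` is the identity on `H¹(Γ_K, E[m])` read on the bottom layer
`κ.layerSubgroup 0 = Γ_K` (inner automorphisms act trivially; Serre, *Local Fields*, VII.§5 Prop. 3).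
[cite: SerreLocalFields1979, VII.§5 Prop. 3] -/
theorem conjH1_layerZero_apply (m : ℤ) (σ : Field.absoluteGaloisGroup K)
    (c : V.torsionH1Over m (κ.layerSubgroup 0)) :
    conjH1 (κ.layerSubgroup 0) (geomTorsion V m) σ c = c := by
  have hσ : σ ∈ κ.layerSubgroup 0 := by
    rw [ZpExtension.layerSubgroup_zero]; trivial
  rw [Literature.NumberTheory.EllipticCurves.conjH1_of_mem_holds (κ.layerSubgroup 0) (geomTorsion V m) hσ,
    AddMonoidHom.id_apply]

/-- **`S_p(E/K)` is SATURATED in `S_{p,rel}(E/K)`** (bottom layer `K^{ac}_0 = K` of a `ℤ_p`-tower; any set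
`P` of relaxed places): if `x ∈ S_{p,rel}(E/K)` and `N · x ∈ S_p(E/K)` for some integer `N ≠ 0`, then
`x ∈ S_p(E/K)` — the relaxed local conditions at the places of `P` are recovered by T4
(`localResTorsionOverOfEmb_eq_zero_of_zsmul`), the others and the compatibility are part of
`S_{p,rel}`; `relaxed ⊓ localKummer = compact` (p441800). I.e. `S_{p,rel}(E/K)/S_p(E/K)` is TORSION-FREE,
so «relaxed = compact at the bottom» (half of D117's stub S_sat) is a pure RANK statement.
[cite: BurungaleKobayashiNakamuraOta2026, §3.1.2 (arXiv:2608.06879 p. 16) (the relaxed / `f` local conditions; shape only)]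
[cite: BlochKato1990, §3 Example 3.11] [cite: Tate1976K2, §2 (shape only)] -/
theorem mem_compactSelmerOver_of_zsmul_mem {P : Set (HeightOneSpectrum (𝓞 K))}
    {x : V.torsionH1Pi p (κ.layerSubgroup 0)}
    (hx : x ∈ V.relaxedCompactSelmerOver (κ.layerSubgroup 0) p P) {N : ℤ} (hN : N ≠ 0)
    (hNx : N • x ∈ V.compactSelmerOver (κ.layerSubgroup 0) p) :
    x ∈ V.compactSelmerOver (κ.layerSubgroup 0) p := by
  have hcomp : x ∈ V.compatiblePi (κ.layerSubgroup 0) p := (mem_relaxedCompactSelmerOver_iff.1 hx).2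
  have hsel := ((V.mem_compactSelmerOver_iff (κ.layerSubgroup 0) p (N • x)).1 hNx).1
  rw [← V.relaxedCompactSelmerOver_inf_localKummerPi (κ.layerSubgroup 0) p P]
  refine ⟨hx, mem_localKummerPi_iff.2 fun k ↦ mem_localKummerTorsionOver_iff.2 fun v _ σ ↦ ?_⟩
  rw [conjH1_layerZero_apply]
  refine localResTorsionOverOfEmb_eq_zero_of_zsmul V p (κ.layerSubgroup 0) _ hcomp hN (fun j ↦ ?_) k
  have hj := hsel j
  simp only [WeierstrassCurve.selmerTorsionOver, AddSubgroup.mem_inf, AddSubgroup.mem_iInf,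
    AddSubgroup.mem_comap, AddMonoidHom.mem_ker, conjH1_layerZero_apply] at hj
  have := hj.1 v σ
  rwa [Pi.smul_apply] at this

/-- The same with a natural-number multiple. [cite: BlochKato1990, §3 Example 3.11] -/
theorem mem_compactSelmerOver_of_nsmul_mem {P : Set (HeightOneSpectrum (𝓞 K))}
    {x : V.torsionH1Pi p (κ.layerSubgroup 0)}
    (hx : x ∈ V.relaxedCompactSelmerOver (κ.layerSubgroup 0) p P) {n : ℕ} (hn : n ≠ 0)
    (hnx : n • x ∈ V.compactSelmerOver (κ.layerSubgroup 0) p) :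
    x ∈ V.compactSelmerOver (κ.layerSubgroup 0) p :=
  mem_compactSelmerOver_of_zsmul_mem V p κ hx (Int.natCast_ne_zero.2 hn) (by rwa [natCast_zsmul])

/-- **Corollary (the shape S_sat consumes): if `S_p(E/K)` has FINITE index in `S_{p,rel}(E/K)` then they
are EQUAL** (`relIndex ≠ 0` gives the uniform multiple `[S_rel : S_p] · x ∈ S_p`,
`AddSubgroup.nsmul_relIndex_mem`; then saturation). So D117's (sat) «`S_{p,rel}(E/K) ≤ tors ⊔ E(K) ⊗ ℤ_p`»
follows from «`[S_{p,rel} : S_p] < ∞`» (a rank count) and «`S_p ≤ tors ⊔ E(K) ⊗ ℤ_p`» (`T_pШ(E/K) = 0`).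
[cite: BurungaleKobayashiNakamuraOta2026, §3.1.2 (arXiv:2608.06879 p. 16) (shape only)]
[cite: BlochKato1990, §3 Example 3.11] -/
theorem relaxedCompactSelmerOver_eq_of_relIndex_ne_zero (P : Set (HeightOneSpectrum (𝓞 K)))
    (h : (V.compactSelmerOver (κ.layerSubgroup 0) p).relIndex
      (V.relaxedCompactSelmerOver (κ.layerSubgroup 0) p P) ≠ 0) :
    V.relaxedCompactSelmerOver (κ.layerSubgroup 0) p P = V.compactSelmerOver (κ.layerSubgroup 0) p := by
  refine le_antisymm (fun x hx ↦ ?_) (V.compactSelmerOver_le_relaxedCompactSelmerOver _ p P)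
  exact mem_compactSelmerOver_of_nsmul_mem V p κ hx h
    (AddSubgroup.nsmul_relIndex_mem (V.compactSelmerOver (κ.layerSubgroup 0) p) hx)

/-- **Hence (sat) from a finite index and `T_pШ = 0`**: if `[S_{p,rel}(E/K) : S_p(E/K)] < ∞` and
`S_p(E/K) ≤ tors ⊔ E(K) ⊗ ℤ_p`, then `S_{p,rel}(E/K) ≤ tors ⊔ E(K) ⊗ ℤ_p` — input (i) of
`LocalIndexSplitReading.hasLocalBottomIndexExp_of_inputs` (p462109) from its two halves.
[cite: BurungaleKobayashiNakamuraOta2026, §3.1.2 (arXiv:2608.06879 p. 16) (shape only)]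
[cite: PerrinRiou1987BSMF, §0 pp. 401–402 (`0 → E(L) ⊗ ℤ_p → S_p(L) → T_pШ → 0`)] -/
theorem relaxedCompactSelmerOver_le_of_relIndex_ne_zero (P : Set (HeightOneSpectrum (𝓞 K)))
    (h : (V.compactSelmerOver (κ.layerSubgroup 0) p).relIndex
      (V.relaxedCompactSelmerOver (κ.layerSubgroup 0) p P) ≠ 0)
    (hSha : V.compactSelmerOver (κ.layerSubgroup 0) p ≤
      AddCommGroup.torsion (V.torsionH1Pi p (κ.layerSubgroup 0)) ⊔
        V.mordellWeilKummerSpan p (κ.layerSubgroup 0)) :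
    V.relaxedCompactSelmerOver (κ.layerSubgroup 0) p P ≤
      AddCommGroup.torsion (V.torsionH1Pi p (κ.layerSubgroup 0)) ⊔
        V.mordellWeilKummerSpan p (κ.layerSubgroup 0) := by
  rw [relaxedCompactSelmerOver_eq_of_relIndex_ne_zero V p κ P h]
  exact hSha

end Bottom

end RelaxedSelmerSaturation

end Summit.BirchSwinnertonDyer.BirchSwinnertonDyer.Theorems.RamifiedSevenEllipticUnits

end
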